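import Literature.NumberTheory.GaloisRepresentations.SerreWeightEqTwoShapesProofs
import Literature.NumberTheory.GaloisRepresentations.ModPGaloisRepKummerProofs
import HarnessLib

/-!
# Serre's weight in the level-two case: `k(ρ̄) = 1 + q a + b` for the shape `diag(ψ₂^{a+qb}, ψ₂^{qa+b})`,
# `0 ≤ a < b ≤ q - 1` (Serre 1987, §2.2) — proofs

`Proofs` file (theorems only: no definition, no named fact, no instance, no `sorry`), topic
`NumberTheory/GaloisRepresentations`; sequel of `SerreWeightEqTwoShapesProofs` (which evaluates the recipe in the
special case `(a, b) = (0, 1)`, `k = 2`). Serre, Duke Math. J. 54 (1987), §2.2: *"Supposons que `φ, φ'` soient de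
niveau `2`. … On peut écrire `φ` de manière unique sous la forme `φ = ψ^{a+pb} = ψ^a ψ'^b` avec `0 ≤ a, b ≤ p − 1` …
on a `a ≠ b` … `φ' = ψ^b ψ'^a` … quitte à permuter `φ` et `φ'` on peut supposer `a < b`. On pose `k = 1 + pa + b`."*

* `ModPGaloisRep.eq_of_hasLevelTwoInertiaShape` — **uniqueness of the normalised level-two exponents**: if
  `ρ̄|I_F ≃ diag(ψ₂^{a+qb}, ψ₂^{qa+b})` and `≃ diag(ψ₂^{a'+qb'}, ψ₂^{qa'+b'})` with `a < b ≤ q − 1`, `a' < b' ≤ q − 1`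
  (any two uniformisers), then `(a, b) = (a', b')`. Proof: the diagonal characters of two triangular forms of
  `ρ̄|I_F` agree up to order (`diagChar_eq_or_eq_swap`); `ψ₂` has exact order `q² − 1`
  (`fundamentalCharacter_pow_eq_one_iff`; independence of the uniformiser `fundamentalCharacter_eq_holds`), and
  the exponents `a + qb`, `qa + b` lie in `[1, q² − 2]`, so the congruences are equalities of base-`q` expansions;
  the swapped case contradicts `a < b`, `a' < b'`.
* `ModPGaloisRep.serreWeightLocal_eq_of_hasLevelTwoInertiaShape` — hence `serreWeightLocal ρ̄ ι = 1 + q a + b`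
  (the recipe is in its first case and the set of level-two weights is the singleton `{1 + qa + b}`);
* `ModPGaloisRep.serreWeight_eq_of_hasLevelTwoInertiaShape` — the global wrapper at a local restriction datum
  (`q = p`): `serreWeight p ρ̄ loc ι = 1 + p a + b`.

Used by the elliptic-curve side (`SupersingularInertiaShapeExponentProofs`) to evaluate `k = 6 = 1 + 3·1 + 2` on the
Kodaira-III half of the tame quartic class at `p = 3` (shape `{ψ₂⁷, ψ₂⁵}`).

## References

* [Serre1987] J.-P. Serre, Duke Math. J. 54 (1987), §2.1 Prop. 1, §2.2 (2.2.1)–(2.2.4).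
* [SerreInventiones1972] J.-P. Serre, Invent. Math. 15 (1972), §1.3 Prop. 2, §1.7 Prop. 3.
-/

noncomputable section

open scoped Valued
open Field ValuativeRel

namespace Literature.NumberTheory.GaloisRepresentations
namespace ModPGaloisRep

open GaloisRepresentations.IsNonarchimedeanLocalField InertiaShape

universe u v

section LevelTwo

variable {F : Type u} [Field F] [ValuativeRel F] [TopologicalSpace F] [IsNonarchimedeanLocalField F]
variable {k : Type v} [Field k] [TopologicalSpace k]
variable {ρ : ModPGaloisRep F k 2} {ι : absIntegers 𝒪[F] F ⧸ absMaximalIdeal F →+* k}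

/-- **Base-`q` digits**: for `a, a' < q`, `a + q b = a' + q b'` forces `a = a'` and `b = b'` (private
arithmetic helper). [folklore] -/
private theorem digits_eq_of_add_mul_eq {q a b a' b' : ℕ} (ha : a < q) (ha' : a' < q)
    (h : a + q * b = a' + q * b') : a = a' ∧ b = b' := by
  have hq : 0 < q := by omega
  have hb : b = b' := by
    have h1 : (a + q * b) / q = b := by
      rw [Nat.add_mul_div_left _ _ hq, Nat.div_eq_of_lt ha, zero_add]
    have h2 : (a' + q * b') / q = b' := by
      rw [Nat.add_mul_div_left _ _ hq, Nat.div_eq_of_lt ha', zero_add]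
    rw [← h1, ← h2, h]
  subst hb
  exact ⟨by omega, rfl⟩

/-- **Two naturals in `[1, N - 1]` (here `0 < x, y < N`) that are congruent modulo `N` in the sense `N ∣ x - y` and
`N ∣ y - x` (truncated subtraction) are equal** (private arithmetic helper). [folklore] -/
private theorem eq_of_dvd_sub_of_dvd_sub {N x y : ℕ} (hx : x < N) (hy : y < N) (h₁ : N ∣ x - y) (h₂ : N ∣ y - x) :
    x = y := by
  rcases Nat.lt_or_ge x y with hlt | hge
  · have : y - x = 0 := Nat.eq_zero_of_dvd_of_lt h₂ (by omega)
    omega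
  · have : x - y = 0 := Nat.eq_zero_of_dvd_of_lt h₁ (by omega)
    omega

omit [TopologicalSpace k] in
/-- **`ψ₂^x = ψ₂^y` with `x, y < q² − 1` forces `x = y`** (`ψ₂` has exact order `q² − 1`,
`fundamentalCharacter_pow_eq_one_iff`; `ι` is injective, `residueEmbedding_injective`).
[cite: SerreInventiones1972, §1.3 Prop. 2 and §1.7] -/
theorem eq_of_fundamentalCharacter_two_pow_eq (ι : absIntegers 𝒪[F] F ⧸ absMaximalIdeal F →+* k)
    (ϖ : 𝒪[F]) (hϖ : Irreducible ϖ) {x y : ℕ} (hx : x < residueFieldCard F ^ 2 - 1)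
    (hy : y < residueFieldCard F ^ 2 - 1)
    (h : fundamentalCharacter F 2 ι ϖ hϖ ^ x = fundamentalCharacter F 2 ι ϖ hϖ ^ y) : x = y := by
  have hι := residueEmbedding_injective (F := F) ι
  set ψ := fundamentalCharacter F 2 ι ϖ hϖ with hψ
  have key : ∀ {x y : ℕ}, ψ ^ x = ψ ^ y → residueFieldCard F ^ 2 - 1 ∣ x - y := by
    intro x y hxy
    rcases Nat.lt_or_ge x y with hlt | hge
    · rw [Nat.sub_eq_zero_of_le hlt.le]; exact dvd_zero _
    · rw [← fundamentalCharacter_pow_eq_one_iff two_ne_zero ι hι ϖ hϖ]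
      ext σ : 1
      have hσ := congrArg (fun χ : absInertia F →* kˣ => χ σ) hxy
      simp only [MonoidHom.pow_apply] at hσ
      rw [MonoidHom.pow_apply, MonoidHom.one_apply, pow_sub _ hge, hσ, mul_inv_cancel]
  exact eq_of_dvd_sub_of_dvd_sub hx hy (key h) (key h.symm)

/-- **Uniqueness of the normalised level-two exponents** (Serre 1987 §2.2: "de manière unique … quitte à permuter
… `a < b`"): if `ρ̄|I_F ≃ diag(ψ₂^{a+qb}, ψ₂^{qa+b})` (w.r.t. a uniformiser `ϖ`) and also
`ρ̄|I_F ≃ diag(ψ₂^{a'+qb'}, ψ₂^{qa'+b'})` (w.r.t. a uniformiser `ϖ'`), with `a < b`, `b + 1 ≤ q`, `a' < b'`,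
`b' + 1 ≤ q`, then `a = a'` and `b = b'`. [cite: Serre1987, §2.1 Prop. 1 and §2.2 (2.2.1)–(2.2.2)] -/
theorem eq_of_hasLevelTwoInertiaShape {ϖ ϖ' : 𝒪[F]} {hϖ : Irreducible ϖ} {hϖ' : Irreducible ϖ'}
    {a b a' b' : ℕ} (hab : a < b) (hb : b + 1 ≤ residueFieldCard F) (hab' : a' < b')
    (hb' : b' + 1 ≤ residueFieldCard F) (h : ρ.HasLevelTwoInertiaShape ι ϖ hϖ a b)
    (h' : ρ.HasLevelTwoInertiaShape ι ϖ' hϖ' a' b') : a = a' ∧ b = b' := by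
  obtain ⟨P, hP⟩ := h
  obtain ⟨Q, hQ⟩ := h'
  set q := residueFieldCard F with hqdef
  have hq1 : 1 < q := one_lt_residueFieldCard F
  -- one uniformiser
  have hψψ : fundamentalCharacter F 2 ι ϖ' hϖ' = fundamentalCharacter F 2 ι ϖ hϖ :=
    fundamentalCharacter_eq_holds F 2 ι ϖ' ϖ hϖ' hϖ
  set ψ := fundamentalCharacter F 2 ι ϖ hϖ with hψ
  -- the two triangular (diagonal) forms of `ρ̄|I_F`
  have hf : ∀ σ, (conjRestrict ρ P σ : Matrix (Fin 2) (Fin 2) k) 1 0 = 0 := by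
    intro σ; rw [conjRestrict_apply, hP σ]; rfl
  have hf' : ∀ σ, (conjRestrict ρ Q σ : Matrix (Fin 2) (Fin 2) k) 1 0 = 0 := by
    intro σ; rw [conjRestrict_apply, hQ σ]; rfl
  have hconj : ∀ σ, conjRestrict ρ Q σ = (Q * P⁻¹) * conjRestrict ρ P σ * (Q * P⁻¹)⁻¹ := by
    intro σ
    rw [conjRestrict_apply, conjRestrict_apply, mul_inv_rev, inv_inv]
    group
  have hd0 : ∀ σ, diagChar (conjRestrict ρ P) hf 0 σ = ψ σ ^ (a + q * b) := by
    intro σ; ext; rw [coe_diagChar_apply, conjRestrict_apply, hP σ]; simp [hqdef, hψ]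
  have hd1 : ∀ σ, diagChar (conjRestrict ρ P) hf 1 σ = ψ σ ^ (q * a + b) := by
    intro σ; ext; rw [coe_diagChar_apply, conjRestrict_apply, hP σ]; simp [hqdef, hψ]
  have he0 : ∀ σ, diagChar (conjRestrict ρ Q) hf' 0 σ = ψ σ ^ (a' + q * b') := by
    intro σ; ext; rw [coe_diagChar_apply, conjRestrict_apply, hQ σ]; simp [hqdef, hψψ, hψ]
  have he1 : ∀ σ, diagChar (conjRestrict ρ Q) hf' 1 σ = ψ σ ^ (q * a' + b') := by
    intro σ; ext; rw [coe_diagChar_apply, conjRestrict_apply, hQ σ]; simp [hqdef, hψψ, hψ]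
  -- the exponents lie in `[0, q² - 2]`
  have hN : residueFieldCard F ^ 2 - 1 = q ^ 2 - 1 := by rw [hqdef]
  have hx0 : a + q * b < q ^ 2 - 1 := by
    have : a + q * b + 2 ≤ q ^ 2 := by nlinarith
    omega
  have hx1 : q * a + b < q ^ 2 - 1 := by
    have : q * a + b + 2 ≤ q ^ 2 := by nlinarith
    omega
  have hy0 : a' + q * b' < q ^ 2 - 1 := by
    have : a' + q * b' + 2 ≤ q ^ 2 := by nlinarith
    omega
  have hy1 : q * a' + b' < q ^ 2 - 1 := by
    have : q * a' + b' + 2 ≤ q ^ 2 := by nlinarith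
    omega
  have powext : ∀ {x y : ℕ}, (∀ σ, ψ σ ^ x = ψ σ ^ y) → x < q ^ 2 - 1 → y < q ^ 2 - 1 → x = y := by
    intro x y hxy hx hy
    refine eq_of_fundamentalCharacter_two_pow_eq ι ϖ hϖ (hN ▸ hx) (hN ▸ hy) ?_
    ext σ : 1
    rw [MonoidHom.pow_apply, MonoidHom.pow_apply]
    exact hxy σ
  rcases diagChar_eq_or_eq_swap (conjRestrict ρ P) (conjRestrict ρ Q) hf hf' (Q * P⁻¹) hconj with
    ⟨h0, -⟩ | ⟨h0, h1⟩
  · -- same order: `a + q b = a' + q b'`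
    have hxy : a + q * b = a' + q * b' :=
      powext (fun σ ↦ by rw [← hd0 σ, ← he0 σ, h0]) hx0 hy0
    exact digits_eq_of_add_mul_eq (by omega) (by omega) hxy
  · -- swapped: `a + q b = q a' + b'` and `q a + b = a' + q b'` — contradicts `a < b`, `a' < b'`
    have hxy : a + q * b = b' + q * a' := by
      rw [show b' + q * a' = q * a' + b' by ring]
      exact powext (fun σ ↦ by rw [← hd0 σ, ← he1 σ, h0]) hx0 hy1
    have hxy' : b + q * a = a' + q * b' := by
      rw [show b + q * a = q * a + b by ring]
      exact powext (fun σ ↦ by rw [← hd1 σ, ← he0 σ, h1]) hx1 hy0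
    obtain ⟨hab1, hba1⟩ := digits_eq_of_add_mul_eq (q := q) (by omega) (by omega) hxy
    omega

variable (ρ ι)

/-- **Serre 1987 §2.2: in the level-two case `k(ρ̄_F) = 1 + q a + b`.** If `ρ̄|I_F ≃ diag(ψ₂^{a+qb}, ψ₂^{qa+b})`
with `0 ≤ a < b ≤ q − 1` then `serreWeightLocal ρ̄ ι = 1 + q a + b`: `1 + qa + b` is a level-two weight, so the
recipe is in its first case, and by `eq_of_hasLevelTwoInertiaShape` every level-two weight of `ρ̄` equals it.
[cite: Serre1987, §2.2 ("On pose k = 1 + pa + b", (2.2.4))] -/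
theorem serreWeightLocal_eq_of_hasLevelTwoInertiaShape {ϖ : 𝒪[F]} (hϖ : Irreducible ϖ) {a b : ℕ}
    (hab : a < b) (hb : b + 1 ≤ residueFieldCard F) (h : ρ.HasLevelTwoInertiaShape ι ϖ hϖ a b) :
    ρ.serreWeightLocal ι = 1 + residueFieldCard F * a + b := by
  classical
  have hw : ρ.IsLevelTwoWeight ι (1 + residueFieldCard F * a + b) := ⟨a, b, hab, hb, ⟨ϖ, hϖ, h⟩, rfl⟩
  have huniq : ∀ m, ρ.IsLevelTwoWeight ι m → m = 1 + residueFieldCard F * a + b := by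
    rintro m ⟨a', b', hab', hb', ⟨ϖ', hϖ', h'⟩, rfl⟩
    obtain ⟨rfl, rfl⟩ := eq_of_hasLevelTwoInertiaShape hab' hb' hab hb h' h
    rfl
  unfold serreWeightLocal
  rw [if_pos ⟨_, hw⟩]
  refine le_antisymm (Nat.sInf_le hw) (le_csInf ⟨_, hw⟩ fun m hm => (huniq m hm).ge)

end LevelTwo

/-! ### The global wrapper -/

section Global

variable {k : Type v} [Field k] [TopologicalSpace k]
variable {p : ℕ} {ρ : ModPGaloisRep ℚ k 2} (loc : LocalRestrictionAt p ρ)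
  (ι : absIntegers 𝒪[loc.F] loc.F ⧸ absMaximalIdeal loc.F →+* k)

/-- **`k(ρ̄) = 1 + p a + b` in the level-two case** at a local restriction datum `loc` (`F ≅ ℚ_p`, uniformiser `p`,
`q = p`): `ρ̄|I_p ≃ diag(ψ₂^{a+pb}, ψ₂^{pa+b})`, `0 ≤ a < b ≤ p − 1`, gives `serreWeight p ρ̄ loc ι = 1 + p a + b`.
[cite: Serre1987, §2.2 (2.2.4)] -/
theorem serreWeight_eq_of_hasLevelTwoInertiaShape {a b : ℕ} (hab : a < b) (hb : b + 1 ≤ p)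
    (h : loc.rep.HasLevelTwoInertiaShape ι (p : 𝒪[loc.F]) loc.irreducible_natCast a b) :
    serreWeight p ρ loc ι = 1 + p * a + b := by
  have hq := loc.residueFieldCard_eq
  have h1 := serreWeightLocal_eq_of_hasLevelTwoInertiaShape loc.rep ι loc.irreducible_natCast hab (hq.symm ▸ hb) h
  rw [hq] at h1
  exact h1

end Global

end ModPGaloisRep
end Literature.NumberTheory.GaloisRepresentations

end
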